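import Summits.HodgeConjecture.HodgeConjecture.Theorems.F0P6aChartFramePin                       -- ★ re-homed frame pin `IsChartOfFrame` (namespace kept `…Cruxes.HLiu418.F0P6aChartFramePin`); by import (D) `AuxChartGS` (★ `Theorems.F0P6aPELWitnessEDefs`), ★ 7b `SymplecticFrameV`∕`auxToGspFinV`, ★ E2 `auxComplexStructureV`
import Summits.HodgeConjecture.HodgeConjecture.Theorems.F0P6aSpecialPairForwardLawAtCorrespondent     -- ★ p849999 (LA4-p03): forward law at a GIVEN reflex correspondent (over ★ p849972 (S2a♭) + ★ p849924)
import Literature.AlgebraicGeometry.ShimuraVarieties.UnitaryCurveSpecialPairOfAuxComplexStructure      -- ★ E2 `isSpecial_auxComplexStructureV_curve` (the `hJsp` clause at `J_{Φ′}`)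
import Literature.NumberTheory.ComplexMultiplication.CMTypeKottwitzCensusRankTwo                        -- ★ `mem_flip_bar_self : ι₁ ∈ flip ι₁ (bar Φ)`
import Literature.AlgebraicGeometry.ShimuraVarieties.UnitaryCurveConjugateSliceEqOfForwardTwistedRecip   -- ★ p849947 (LA4-p03): (S3) head with the FORWARD law (`gal_comp_sliceComplex_comp_gal_eq_sliceTwo_of_forward_recip`)
import Literature.AlgebraicGeometry.ShimuraVarieties.UnitaryShimuraCurveRecordEmpty                       -- ★ `RecordSystemGS.negCone_nonempty` (a special point exists)
import Literature.AlgebraicGeometry.ShimuraVarieties.UnitaryCurveConjugateSliceDescends                  -- ★ p850264 (LA4-p03): the (S3→S4) leg `gal_comp_slice_fst_eq_sliceTwo_fst` (Fi-level)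
import HarnessLib

/-!
# (S3♯) AT A CHART OF A FRAME — the FORWARD twisted law `σL|ℚ • C.f[ι₁w, a] = f₂[ι₁w, d♯·a]`, the (S3)∘(S3♯) zip, and LEG-C♯ `(1 × Spec γ) ≫ ε ≫ pr₁ = ε₂ ≫ pr₁`
# ([Milne 2005] Def. 12.8 (62), Lemma 13.5, Thm. 13.6; [Deligne 1971] 5.11; RSZ §3.2: the sheets of `M_K ⊗_F Fᵢ`)

Cell `hodgecm-mathlib` (D-0151), FLOOR 0, P6 «MOD programme», crux hLiu418 (stmt-HodgeConjecture-24832, `--supports`, count-neutral), line «L4».  ★-LANE TWIN of the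
HOME Lines snippet `F0/P6/L4/LA4-p03/g2/S3sharp-htw-chart.v3.LA4-p03g2.lean` (LA4-p03 (g2), DEAL #28; consumed BY COPY by the (S8)∕LEG-E closer
`Lines/F0_P6a_StubESHEET.lean`, E-pen A-p01 (g28) ∕ LA7-p01): the SAME three theorems, proofs byte-identical, now importable from `Theorems/` because the frame pin
`IsChartOfFrame` is ★ re-homed (`Theorems.F0P6aChartFramePin`, namespace kept) — so the ★-lane twin of the LEG-E(γ′) closer (RE-HOME at rung 0) imports LEG-C♯
instead of carrying 250 lines by copy (LA4-plan (g2) 09:09:56Z (4): «LEG-C♯ = LA4-p03 (g2) snippet v3 §1»).  Namespace `…Theorems.F0P6aForwardLawAtChartOfFrame` (the HOME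
snippet՚s `…Cruxes.HLiu418.F0P6aS3SharpSnippet` is left to the Lines lane, so no environment ever holds two copies of a name).

At a chart `C : AuxChartGS …` PINNED on an E1 frame `Fr` (`IsChartOfFrame hΦ C ξ k Fr`: `C.J = J_{Φ′}(Fr)`, `C.b = ũ_V(·, 1)`), for `σL ∈ Aut(ℂ∕ι₁F)` (`F∕ℚ`
Galois), a GIVEN `E♯`-idèle `uE ↔ σL` (`E♯ = E♯(Φ′)`, `Φ′ = flip ι₁ (bar Φ)` — the E2 type of the chart), `t = N_{E♯,Φ′}(uE)` and ANY point map `f₂` with Siegel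
shadow `[C.J v, C.b a · ũ_V(1, t)]` (the (S2b) reading of the tensored slice `ψ_𝔞`, ★ p849685, with the junction's `z = t`):
§1 **`exists_forward_law_of_chartOfFrame`** — an `F`-correspondent `s′ ↔ σL` and a twist `d♯` with `σL|ℚ • C.f[ι₁w, a] = f₂[ι₁w, d♯·a]` for all `a` (the
`{s} hs {d} hd hfw` inputs of ★ `RecordSystemGS.conjSlice_eq_sliceTwo_of_forward_recip`, p849947).  ONE CALL of ★ `exists_forward_law_of_correspondent_algEquiv`
(p849999) with the chart's fields; `hJsp` discharged at `J_{Φ′}` by ★ `isSpecial_auxComplexStructureV_curve` through the pin `C.J = J_{Φ′}`; (U3)∕(D3) from the field `C.junction`.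
§2 **`gal_conj_slice_eq_sliceTwo_of_chartOfFrame`** — for complex slices `ψ` (reading `C.f`) and `ψ₂` (reading `f₂`), `gal σL⁻¹ ≫ ψ.left ≫ gal σL|ℚ = ψ₂.left`,
with `hdet`, separatedness of `𝓜.M` (`C.quasiProjective_M`), the junction homeomorphism (`S.exists_homeomorph_complexFibre`) and the special point (`S.negCone_nonempty` +
★ `exists_embedding_mem_negCone`) ALL DISCHARGED.  §3 **`gal_comp_chartSlice_fst_eq_sliceTwo_fst_of_chartOfFrame`** (LEG-C♯, `Fi`-level) — from the letter's `(ε, hε)`,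
the junction's `(γ, γ′, hγ′, hι, uE, t)` and LEG-B's `(f₂, hf₂, ε₂, hε₂)`: `GaloisDescent.gal Fi (M_Kc) γ⁻¹ ≫ ε.left ≫ pr₁ = ε₂.left ≫ pr₁` (★ p850264 at the chart;
`σL := AlgEquiv.ofRingEquiv hι`).
HONEST LABEL: HC_CM is proved only modulo the 7 printed citations (2 remaining: hLiu418 24832, h413 24833) until rung 0 closes; this file closes no statement item.
-/

set_option autoImplicit false

noncomputable section

set_option linter.dupNamespace false

namespace Summit.HodgeConjecture.HodgeConjecture.Theorems.F0P6aForwardLawAtChartOfFrame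

open CategoryTheory CategoryTheory.Limits AlgebraicGeometry Matrix NumberField IsDedekindDomain
open Literature.AlgebraicGeometry.ModuliOfAbelianVarieties
open Literature.AlgebraicGeometry.Motives (SchemeOver ComplexPoints AlgPoints specOver CMType GaloisDescent.bc GaloisDescent.gal)
open Literature.AlgebraicGeometry.Motives.AbelianVariety (bcSpec)
open Literature.NumberTheory.Automorphic Literature.NumberTheory.Automorphic.UnitaryGroup
open Literature.NumberTheory.Automorphic.Liu2021.AppendixC (C5.OpenCompactSubgroup C5.SmallLevel)
open Literature.NumberTheory.ComplexMultiplication (reflexNormFiniteIdele)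
open Literature.NumberTheory.ComplexMultiplication.CMTypeOps (flip bar mem_flip_bar_self)
open Literature.AlgebraicGeometry.ShimuraVarieties
open Literature.AlgebraicGeometry.ShimuraVarieties.UnitaryCanonicalModel (RecordSystemGS IsArtinCorrespondent recipFactor IsDiagTwistGS ShimuraSetGS)
open Literature.AlgebraicGeometry.ShimuraVarieties.UnitaryCanonicalModel.Aux (torusFinAdelic reflexField numberField_reflexField)
open Literature.AlgebraicGeometry.ShimuraVarieties.UnitaryCurve
open Literature.AlgebraicGeometry.ShimuraVarieties.UnitaryCurve.AuxV
open Summit.HodgeConjecture.HodgeConjecture.Cruxes.HLiu418.F0P6aPELWitnessE (AuxChartGS IsCMTypeThrough GSAdele)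
open Summit.HodgeConjecture.HodgeConjecture.Cruxes.HLiu418.F0P6aChartFramePin (IsChartOfFrame)
open Summit.HodgeConjecture.HodgeConjecture.Theorems.F0P6aSpecialPairForwardLawAtCorrespondent (exists_forward_law_of_correspondent_algEquiv)

/-- **(S3♯) AT A CHART OF A FRAME — the forward twisted law for the (S8) closer.** For `F∕ℚ` Galois, `J⋆` hermitian, a chart `C` with `IsChartOfFrame hΦ C ξ k Fr`,
`σL ∈ Aut_F(ℂ)`, a GIVEN reflex idèle `uE ↔ σL` of `E♯ = reflexField F Φ′ ι₁`, `Φ′ = flip ι₁ (bar Φ)`, `t = N_{E♯,Φ′}(uE)`, and a point map `f₂` with shadow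
`[C.J v, C.b a · ũ_V(1,t)]`: `∃ s′ d♯, s′ ↔ σL ∧ IsDiagTwistGS F J⋆ w (r(s′)) d♯ ∧ ∀ a, σL|ℚ • C.f[ι₁w, a] = f₂[ι₁w, d♯·a]`.
[cite: Milne2005ShimuraVarieties, Def. 12.8 (62) p. 114, Thm. 13.6 p. 118] [cite: Deligne1971TravauxShimura, 5.11 p. 158] [cite: RapoportSmithlingZhang2020Diagonal, §3.2 p. 11] -/
theorem exists_forward_law_of_chartOfFrame {F : Type} [Field F] [NumberField F] [IsCMField F] [IsGalois ℚ F] {ι₁ : F →+* ℂ}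
    {Jstar : Matrix (Fin 2) (Fin 2) F} (hJ : (Jstar.map (IsCMField.complexConj F))ᵀ = Jstar)
    {K₀ : C5.OpenCompactSubgroup (GSAdele F Jstar)} {S : RecordSystemGS F Jstar ι₁ K₀} {Kc : C5.SmallLevel K₀}
    {Fi : Type} [Field Fi] [NumberField Fi] [Algebra F Fi] {τE : Fi →+* ℂ} {Φ : Set (F →+* ℂ)} (hΦ : IsCMTypeThrough ι₁ Φ)
    (C : AuxChartGS F ι₁ Jstar K₀ S Kc Fi τE Φ) {ξ : F} {k : ℕ} {Fr : SymplecticFrameV F (RingHom.id F) Jstar ((k : ℚ) • ξ) C.g C.δ}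
    (hC : IsChartOfFrame hΦ C ξ k Fr) (σL : letI : Algebra F ℂ := ι₁.toAlgebra; ℂ ≃ₐ[F] ℂ) :
    haveI : NumberField ↥(reflexField F (flip ι₁ (bar (⟨Φ, hΦ.2⟩ : CMType F))) ι₁) :=
      numberField_reflexField F (flip ι₁ (bar (⟨Φ, hΦ.2⟩ : CMType F))) ι₁
    letI : Algebra F ℂ := ι₁.toAlgebra
    ∀ (uE : (FiniteAdeleRing (𝓞 ↥(reflexField F (flip ι₁ (bar (⟨Φ, hΦ.2⟩ : CMType F))) ι₁))
        ↥(reflexField F (flip ι₁ (bar (⟨Φ, hΦ.2⟩ : CMType F))) ι₁))ˣ),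
      IsArtinCorrespondent ↥(reflexField F (flip ι₁ (bar (⟨Φ, hΦ.2⟩ : CMType F))) ι₁)
        (algebraMap ↥(reflexField F (flip ι₁ (bar (⟨Φ, hΦ.2⟩ : CMType F))) ι₁) ℂ) uE σL.toRingEquiv →
    ∀ t : ↥(torusFinAdelic F),
      (t : (FiniteAdeleRing (𝓞 F) F)ˣ) = reflexNormFiniteIdele F (flip ι₁ (bar (⟨Φ, hΦ.2⟩ : CMType F)))
        (reflexField F (flip ι₁ (bar (⟨Φ, hΦ.2⟩ : CMType F))) ι₁) uE →
    ∀ f₂ : ShimuraSetGS F Jstar ι₁ Kc.1.1 → ComplexPoints C.𝓜.M,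
      (∀ (v : Fin 2 → ℂ) (hv : v ∈ negCone (Jstar.map ι₁)) (a : GSAdele F Jstar),
        C.pts (AlgPoints.baseChangeEquiv (algebraMap ℚ ℂ) C.𝓜.M (f₂ (ShimuraSetGS.mk F Jstar ι₁ Kc.1.1 v hv a))) =
          SiegelShimuraSet.mk C.δ (principalLevelSubgroup C.δ C.N) ⟨C.J v, C.hJ v hv⟩ (C.b a * auxToGspFinV Fr (1, t))) →
    ∀ (w : Fin 2 → F) (hw : (fun i => ι₁ (w i)) ∈ negCone (Jstar.map ι₁)),
      ∃ (s' : (FiniteAdeleRing (𝓞 F) F)ˣ) (d' : GSAdele F Jstar),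
        IsArtinCorrespondent F ι₁ s' σL.toRingEquiv ∧ IsDiagTwistGS F Jstar w (recipFactor F s') d' ∧
        ∀ a : GSAdele F Jstar,
          (σL.restrictScalars ℚ) • C.f (ShimuraSetGS.mk F Jstar ι₁ Kc.1.1 (fun i => ι₁ (w i)) hw a) =
            f₂ (ShimuraSetGS.mk F Jstar ι₁ Kc.1.1 (fun i => ι₁ (w i)) hw (d' * a)) := by
  haveI : NumberField ↥(reflexField F (flip ι₁ (bar (⟨Φ, hΦ.2⟩ : CMType F))) ι₁) :=
    numberField_reflexField F (flip ι₁ (bar (⟨Φ, hΦ.2⟩ : CMType F))) ι₁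
  letI : Algebra F ℂ := ι₁.toAlgebra
  intro uE hus t ht f₂ hf₂ w hw
  -- the E2 type of the chart and the pin
  have hΦ'm : ι₁ ∈ (flip ι₁ (bar (⟨Φ, hΦ.2⟩ : CMType F))).1 := mem_flip_bar_self (⟨Φ, hΦ.2⟩ : CMType F) hΦ.1
  obtain ⟨hJe, hbe, -, -⟩ := hC
  have hJC' : ∀ v : Fin 2 → ℂ, v ∈ negCone (Jstar.map ι₁) →
      auxComplexStructureV Fr ι₁ (flip ι₁ (bar (⟨Φ, hΦ.2⟩ : CMType F))) v ∈ C0pm C.δ := fun v hv => hJe ▸ C.hJ v hv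
  -- the special-pair clause at `C.J = J_{Φ′}` (★ E2, through the pin)
  have hJsp : ∀ (w : Fin 2 → F) (hw : (fun i => ι₁ (w i)) ∈ negCone (Jstar.map ι₁)) (b : GL (Fin 2) F),
      (fun i => (b : Matrix (Fin 2) (Fin 2) F) i 1) = w →
      Literature.AlgebraicGeometry.ShimuraVarieties.hermForm (cmConjRingHom F) Jstar (fun i => (b : Matrix (Fin 2) (Fin 2) F) i 0) w = 0 →
      ∀ c : CMStructure C.g C.δ (Fin 2) (fun _ => F),
        (∀ (x : Fin 2 → F) (p : Fin 2) (m : F),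
          c.act x (Fr.β (m • (b : Matrix (Fin 2) (Fin 2) F) *ᵥ Pi.single p 1)) =
            Fr.β ((x p * m) • (b : Matrix (Fin 2) (Fin 2) F) *ᵥ Pi.single p 1)) →
        ∀ Φ' : Fin 2 → CMType F, Φ' 0 = flip ι₁ (bar (⟨Φ, hΦ.2⟩ : CMType F)) →
          (∀ ρ : F →+* ℂ, ρ ∈ (Φ' 1).1 ↔ (ρ ∈ (flip ι₁ (bar (⟨Φ, hΦ.2⟩ : CMType F))).1 ∧ ρ ≠ ι₁) ∨
            ρ = NumberField.ComplexEmbedding.conjugate ι₁) →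
          c.IsSpecial ⟨C.J (fun i => ι₁ (w i)), C.hJ _ hw⟩ Φ' := by
    intro w' hw' b hb1 hperp c hc Φ' h0 h1
    have hpt : (⟨C.J (fun i => ι₁ (w' i)), C.hJ _ hw'⟩ : ↥(C0pm C.δ)) =
        ⟨auxComplexStructureV Fr ι₁ (flip ι₁ (bar (⟨Φ, hΦ.2⟩ : CMType F))) (fun i => ι₁ (w' i)), hJC' _ hw'⟩ :=
      Subtype.ext (congrFun hJe _)
    rw [hpt]
    exact isSpecial_auxComplexStructureV_curve ι₁ Jstar hJ _ Fr hJC' w' hw' b hb1 hperp c hc Φ' h0 h1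
  -- the pin `C.b = ũ_V(·, 1)` and the (U3) block of the chart
  have hb : ∀ a : GSAdele F Jstar, C.b a = auxToGspFinV Fr (a, 1) := fun a => by rw [hbe]; rfl
  have hD3 : haveI : IsLocallyNoetherian (specOver ℚ ℂ).left := inferInstanceAs (IsLocallyNoetherian (Spec (CommRingCat.of ℂ)))
      ∀ (c : (ZMod C.N)ˣ) (Z : Matrix (Fin C.g) (Fin C.g) ℂ) (hZ : Z ∈ siegelUpperHalfSpace C.g)
        (P' : Literature.AlgebraicGeometry.AbelianSchemes.PolarizedAbelianSchemeWithLevel C.g C.N C.δ (specOver ℚ ℂ).left),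
        IsAdmissibleAt C.hδ (C.rep c) Z hZ P' →
          AlgPoints.map (C.ιc c) (C.unif c Z) = AlgPoints.baseChangeEquiv (algebraMap ℚ ℂ) C.𝓜.M (C.𝓜.classifyingMap (specOver ℚ ℂ) P') :=
    fun c Z hZ P' hP' => (C.junction c (C.u c) (C.rep c) (C.rep_spec c).1 (C.rep_spec c).2.1 (C.rep_spec c).2.2.1
      (C.rep_spec c).2.2.2.1 (C.rep_spec c).2.2.2.2 Z hZ).2 P' hP'
  exact exists_forward_law_of_correspondent_algEquiv C.hg C.hδ C.hN C.𝓜 C.ιc C.unif (fun c w => (C.rep_spec c).1 w)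
    (fun c => (C.rep_spec c).2.1) (fun c => (C.rep_spec c).2.2.2.1) hD3 C.pts C.pts_unif ι₁ Jstar hJ _ hΦ'm Fr C.J C.hJ hJsp
    Kc.1.1 C.b hb C.f C.f_pts σL uE hus t ht f₂ hf₂ w hw

/-! ### §2 The (S3)∘(S3♯) ZIP at the chart: the conjugate complex slice IS the second slice -/

set_option maxHeartbeats 400000 in
/-- **(S3)∘(S3♯) AT A CHART OF A FRAME.** In the setting of `exists_forward_law_of_chartOfFrame`, for complex slices `ψ, ψ₂ : (M_Kc)_{ι₁} ⟶ 𝓜.M_ℂ` reading `C.f`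
and `f₂` on points (E5 currency, `t = ψ.left`, `t₂ = ψ₂.left` on the fibre products) and `J⋆` invertible: **`gal σL⁻¹ ≫ ψ.left ≫ gal σL|_ℚ = ψ₂.left`** — ★
`RecordSystemGS.gal_comp_sliceComplex_comp_gal_eq_sliceTwo_of_forward_recip` (p849947) fed by §1, with `hdet` (from `IsUnit J⋆`), `IsSeparated 𝓜.M` (the chart's
`quasiProjective_M`), the junction homeomorphism (★ `RecordSystemGS.exists_homeomorph_complexFibre`) and a special point (★ `RecordSystemGS.negCone_nonempty` + ★
`exists_embedding_mem_negCone`) discharged here.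
[cite: Milne2005ShimuraVarieties, Lemma 13.5 and Thm. 13.6 p. 118; Def. 12.8 (62) p. 114] [cite: Shimura1998, §18.6 (pp. 124–128)] [cite: RapoportSmithlingZhang2020Diagonal, §3.2 p. 11] -/
theorem gal_conj_slice_eq_sliceTwo_of_chartOfFrame {F : Type} [Field F] [NumberField F] [IsCMField F] [IsGalois ℚ F] {ι₁ : F →+* ℂ}
    {Jstar : Matrix (Fin 2) (Fin 2) F} (hJ : (Jstar.map (IsCMField.complexConj F))ᵀ = Jstar) (hJu : IsUnit Jstar)
    {K₀ : C5.OpenCompactSubgroup (GSAdele F Jstar)} {S : RecordSystemGS F Jstar ι₁ K₀} {Kc : C5.SmallLevel K₀}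
    {Fi : Type} [Field Fi] [NumberField Fi] [Algebra F Fi] {τE : Fi →+* ℂ} {Φ : Set (F →+* ℂ)} (hΦ : IsCMTypeThrough ι₁ Φ)
    (C : AuxChartGS F ι₁ Jstar K₀ S Kc Fi τE Φ) {ξ : F} {k : ℕ} {Fr : SymplecticFrameV F (RingHom.id F) Jstar ((k : ℚ) • ξ) C.g C.δ}
    (hC : IsChartOfFrame hΦ C ξ k Fr)
    -- the two complex slices and their point readings (E5 currency)
    (ψ ψ₂ : letI : Algebra F ℂ := ι₁.toAlgebra
      (Literature.AlgebraicGeometry.Motives.baseChangeHom ι₁).obj (S.M.obj Kc) ⟶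
        (Literature.AlgebraicGeometry.Motives.baseChange ℚ ℂ).obj C.𝓜.M)
    (hψ : letI : Algebra F ℂ := ι₁.toAlgebra
      ∀ P : ComplexPoints (S.M.obj Kc),
        (AlgPoints.map ψ (AlgPoints.baseChangeEquiv ι₁ (S.M.obj Kc) P)).left ≫
            Literature.AlgebraicGeometry.Motives.baseChangeHomFst (algebraMap ℚ ℂ) C.𝓜.M =
          (C.f (S.pts Kc P)).left)
    (f₂ : ShimuraSetGS F Jstar ι₁ Kc.1.1 → ComplexPoints C.𝓜.M)
    (hψ₂ : letI : Algebra F ℂ := ι₁.toAlgebra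
      ∀ P : ComplexPoints (S.M.obj Kc),
        (AlgPoints.map ψ₂ (AlgPoints.baseChangeEquiv ι₁ (S.M.obj Kc) P)).left ≫
            Literature.AlgebraicGeometry.Motives.baseChangeHomFst (algebraMap ℚ ℂ) C.𝓜.M =
          (f₂ (S.pts Kc P)).left)
    (t : letI : Algebra F ℂ := ι₁.toAlgebra; GaloisDescent.bc ℂ (S.M.obj Kc) ⟶ GaloisDescent.bc ℂ C.𝓜.M) (ht : t = ψ.left)
    (t₂ : letI : Algebra F ℂ := ι₁.toAlgebra; GaloisDescent.bc ℂ (S.M.obj Kc) ⟶ GaloisDescent.bc ℂ C.𝓜.M) (ht₂ : t₂ = ψ₂.left)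
    (σL : letI : Algebra F ℂ := ι₁.toAlgebra; ℂ ≃ₐ[F] ℂ) :
    haveI : NumberField ↥(reflexField F (flip ι₁ (bar (⟨Φ, hΦ.2⟩ : CMType F))) ι₁) :=
      numberField_reflexField F (flip ι₁ (bar (⟨Φ, hΦ.2⟩ : CMType F))) ι₁
    letI : Algebra F ℂ := ι₁.toAlgebra
    ∀ (uE : (FiniteAdeleRing (𝓞 ↥(reflexField F (flip ι₁ (bar (⟨Φ, hΦ.2⟩ : CMType F))) ι₁))
        ↥(reflexField F (flip ι₁ (bar (⟨Φ, hΦ.2⟩ : CMType F))) ι₁))ˣ),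
      IsArtinCorrespondent ↥(reflexField F (flip ι₁ (bar (⟨Φ, hΦ.2⟩ : CMType F))) ι₁)
        (algebraMap ↥(reflexField F (flip ι₁ (bar (⟨Φ, hΦ.2⟩ : CMType F))) ι₁) ℂ) uE σL.toRingEquiv →
    ∀ tt : ↥(torusFinAdelic F),
      (tt : (FiniteAdeleRing (𝓞 F) F)ˣ) = reflexNormFiniteIdele F (flip ι₁ (bar (⟨Φ, hΦ.2⟩ : CMType F)))
        (reflexField F (flip ι₁ (bar (⟨Φ, hΦ.2⟩ : CMType F))) ι₁) uE →
      (∀ (v : Fin 2 → ℂ) (hv : v ∈ negCone (Jstar.map ι₁)) (a : GSAdele F Jstar),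
        C.pts (AlgPoints.baseChangeEquiv (algebraMap ℚ ℂ) C.𝓜.M (f₂ (ShimuraSetGS.mk F Jstar ι₁ Kc.1.1 v hv a))) =
          SiegelShimuraSet.mk C.δ (principalLevelSubgroup C.δ C.N) ⟨C.J v, C.hJ v hv⟩ (C.b a * auxToGspFinV Fr (1, tt))) →
      GaloisDescent.gal ℂ (S.M.obj Kc) σL⁻¹ ≫ t ≫ GaloisDescent.gal ℂ C.𝓜.M (σL.restrictScalars ℚ) = t₂ := by
  haveI : NumberField ↥(reflexField F (flip ι₁ (bar (⟨Φ, hΦ.2⟩ : CMType F))) ι₁) :=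
    numberField_reflexField F (flip ι₁ (bar (⟨Φ, hΦ.2⟩ : CMType F))) ι₁
  letI : Algebra F ℂ := ι₁.toAlgebra
  intro uE hus tt htt hf₂
  haveI : IsSeparated C.𝓜.M.hom := C.quasiProjective_M.hom_isSeparated
  have hdet : IsUnit Jstar.det := (Matrix.isUnit_iff_isUnit_det Jstar).mp hJu
  obtain ⟨e, he⟩ := S.exists_homeomorph_complexFibre Kc
  obtain ⟨v, hv⟩ := S.negCone_nonempty
  obtain ⟨w, hw⟩ := Literature.AlgebraicGeometry.ShimuraVarieties.UnitaryCanonicalModel.exists_embedding_mem_negCone Jstar ι₁ hv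
  obtain ⟨s', d', hs', hd', hfw⟩ := exists_forward_law_of_chartOfFrame hJ hΦ C hC σL uE hus tt htt f₂ hf₂ w hw
  exact S.gal_comp_sliceComplex_comp_gal_eq_sliceTwo_of_forward_recip Kc C.𝓜.M C.f f₂ ψ ψ₂ hψ hψ₂ t ht t₂ ht₂ hJ hdet e he σL
    hw hs' hd' hfw

/-! ### §3 LEG-C in junction currency (`Fi`-level): the classifying maps of the `γ`-twisted chart slice and of `ψ_𝔞` agree -/

set_option maxHeartbeats 400000 in
/-- **LEG-C OF `stub_SHEET` IN THE CLOSER'S CURRENCY.**  In the letter's context (chart `C` pinned on `Fr`, slice `ε` with its reading `_hε`, `τE ∘ (F → Fᵢ) = ι₁`), for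
`γ ∈ Gal(Fᵢ∕F)` with a lift `γ′ : ℂ ≃+* ℂ` through `τE` fixing `ι₁F` (junction), a reflex correspondent `uE ↔ γ′`, the torus element `t` with `↑t = N_{Φ′}(uE)`,
ANY point map `f₂` with the (S2b) shadow `[C.J v, C.b a · ũ_V(1,t)]` and ANY `Fᵢ`-morphism `ε₂ : X ⟶ 𝓜.M ⊗ Fᵢ` reading `f₂` (LEG-B: the classifying slice of `T_𝔞`):
**`(1 × Spec γ) ≫ ε ≫ pr₁ = ε₂ ≫ pr₁ : X → 𝓜.M`** — ★ `RecordSystemGS.gal_comp_slice_fst_eq_sliceTwo_fst` (p850264) fed by §1 at `σL := AlgEquiv.ofRingEquiv hι` (so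
`σL.toRingEquiv = γ′`), with `hdet`, separatedness and the special point discharged as in §2.  LEG-D consumes it as «`(1 × Spec γ)^* P ≅ T_𝔞`» by fine moduli.
[cite: Milne2005ShimuraVarieties, Thm. 13.6 p. 118, Prop. 13.1 p. 117] [cite: GortzWedhorn2020, §(14.20)] [cite: RapoportSmithlingZhang2020Diagonal, §3.2 p. 11] -/
theorem gal_comp_chartSlice_fst_eq_sliceTwo_fst_of_chartOfFrame {F : Type} [Field F] [NumberField F] [IsCMField F] [IsGalois ℚ F] {ι₁ : F →+* ℂ}
    {Jstar : Matrix (Fin 2) (Fin 2) F} (hJ : (Jstar.map (IsCMField.complexConj F))ᵀ = Jstar) (hJu : IsUnit Jstar)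
    {K₀ : C5.OpenCompactSubgroup (GSAdele F Jstar)} {S : RecordSystemGS F Jstar ι₁ K₀} {Kc : C5.SmallLevel K₀}
    {Fi : Type} [Field Fi] [NumberField Fi] [Algebra F Fi] {τE : Fi →+* ℂ} (hτE : τE.comp (algebraMap F Fi) = ι₁)
    {Φ : Set (F →+* ℂ)} (hΦ : IsCMTypeThrough ι₁ Φ)
    (C : AuxChartGS F ι₁ Jstar K₀ S Kc Fi τE Φ) {ξ : F} {k : ℕ} {Fr : SymplecticFrameV F (RingHom.id F) Jstar ((k : ℚ) • ξ) C.g C.δ}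
    (hC : IsChartOfFrame hΦ C ξ k Fr)
    -- the letter's slice and its reading (`_hε` VERBATIM)
    (ε : (Literature.AlgebraicGeometry.Motives.baseChange F Fi).obj (S.M.obj Kc) ⟶
        (Literature.AlgebraicGeometry.Motives.baseChange ℚ Fi).obj C.𝓜.M)
    (hε : letI : Algebra Fi ℂ := τE.toAlgebra
      ∀ (P : ComplexPoints ((Literature.AlgebraicGeometry.Motives.baseChange F Fi).obj (S.M.obj Kc)))
        (Pflat : letI : Algebra F ℂ := ι₁.toAlgebra; ComplexPoints (S.M.obj Kc)),
        Pflat.left = P.left ≫ pullback.fst (S.M.obj Kc).hom (bcSpec F Fi) →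
        (AlgPoints.map ε P).left ≫ pullback.fst C.𝓜.M.hom (bcSpec ℚ Fi) =
          (letI : Algebra F ℂ := ι₁.toAlgebra; (C.f (S.pts Kc Pflat)).left))
    -- the junction: `γ`, a lift `γ′` through `τE` fixing `ι₁F`
    (γ : Fi ≃ₐ[F] Fi) (γ' : ℂ ≃+* ℂ) (hγ' : ∀ x : Fi, γ' (τE x) = τE (γ x)) (hι : ∀ x : F, γ' (ι₁ x) = ι₁ x) :
    haveI : NumberField ↥(reflexField F (flip ι₁ (bar (⟨Φ, hΦ.2⟩ : CMType F))) ι₁) :=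
      numberField_reflexField F (flip ι₁ (bar (⟨Φ, hΦ.2⟩ : CMType F))) ι₁
    ∀ (uE : (FiniteAdeleRing (𝓞 ↥(reflexField F (flip ι₁ (bar (⟨Φ, hΦ.2⟩ : CMType F))) ι₁))
        ↥(reflexField F (flip ι₁ (bar (⟨Φ, hΦ.2⟩ : CMType F))) ι₁))ˣ),
      IsArtinCorrespondent ↥(reflexField F (flip ι₁ (bar (⟨Φ, hΦ.2⟩ : CMType F))) ι₁)
        (algebraMap ↥(reflexField F (flip ι₁ (bar (⟨Φ, hΦ.2⟩ : CMType F))) ι₁) ℂ) uE γ' →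
    ∀ tt : ↥(torusFinAdelic F),
      (tt : (FiniteAdeleRing (𝓞 F) F)ˣ) = reflexNormFiniteIdele F (flip ι₁ (bar (⟨Φ, hΦ.2⟩ : CMType F)))
        (reflexField F (flip ι₁ (bar (⟨Φ, hΦ.2⟩ : CMType F))) ι₁) uE →
    -- LEG-B: any point map with the (S2b) shadow and any `Fi`-slice reading it
    ∀ f₂ : ShimuraSetGS F Jstar ι₁ Kc.1.1 → ComplexPoints C.𝓜.M,
      (∀ (v : Fin 2 → ℂ) (hv : v ∈ negCone (Jstar.map ι₁)) (a : GSAdele F Jstar),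
        C.pts (AlgPoints.baseChangeEquiv (algebraMap ℚ ℂ) C.𝓜.M (f₂ (ShimuraSetGS.mk F Jstar ι₁ Kc.1.1 v hv a))) =
          SiegelShimuraSet.mk C.δ (principalLevelSubgroup C.δ C.N) ⟨C.J v, C.hJ v hv⟩ (C.b a * auxToGspFinV Fr (1, tt))) →
    ∀ ε₂ : (Literature.AlgebraicGeometry.Motives.baseChange F Fi).obj (S.M.obj Kc) ⟶
        (Literature.AlgebraicGeometry.Motives.baseChange ℚ Fi).obj C.𝓜.M,
      (letI : Algebra Fi ℂ := τE.toAlgebra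
        ∀ (P : ComplexPoints ((Literature.AlgebraicGeometry.Motives.baseChange F Fi).obj (S.M.obj Kc)))
          (Pflat : letI : Algebra F ℂ := ι₁.toAlgebra; ComplexPoints (S.M.obj Kc)),
          Pflat.left = P.left ≫ pullback.fst (S.M.obj Kc).hom (bcSpec F Fi) →
          (AlgPoints.map ε₂ P).left ≫ pullback.fst C.𝓜.M.hom (bcSpec ℚ Fi) =
            (letI : Algebra F ℂ := ι₁.toAlgebra; (f₂ (S.pts Kc Pflat)).left)) →
      GaloisDescent.gal Fi (S.M.obj Kc) γ⁻¹ ≫ ε.left ≫ pullback.fst C.𝓜.M.hom (bcSpec ℚ Fi) =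
        ε₂.left ≫ pullback.fst C.𝓜.M.hom (bcSpec ℚ Fi) := by
  haveI : NumberField ↥(reflexField F (flip ι₁ (bar (⟨Φ, hΦ.2⟩ : CMType F))) ι₁) :=
    numberField_reflexField F (flip ι₁ (bar (⟨Φ, hΦ.2⟩ : CMType F))) ι₁
  letI : Algebra F ℂ := ι₁.toAlgebra
  intro uE hus tt htt f₂ hf₂ ε₂ hε₂
  -- `γ′` as an automorphism of the `F`-algebra `ℂ` (through `ι₁`)
  let σL : ℂ ≃ₐ[F] ℂ := AlgEquiv.ofRingEquiv (f := γ') fun x => hι x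
  have hus' : IsArtinCorrespondent ↥(reflexField F (flip ι₁ (bar (⟨Φ, hΦ.2⟩ : CMType F))) ι₁)
      (algebraMap ↥(reflexField F (flip ι₁ (bar (⟨Φ, hΦ.2⟩ : CMType F))) ι₁) ℂ) uE σL.toRingEquiv := hus
  have hσγ : ∀ x : Fi, σL (τE x) = τE (γ x) := hγ'
  haveI : IsSeparated C.𝓜.M.hom := C.quasiProjective_M.hom_isSeparated
  have hdet : IsUnit Jstar.det := (Matrix.isUnit_iff_isUnit_det Jstar).mp hJu
  obtain ⟨v, hv⟩ := S.negCone_nonempty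
  obtain ⟨w, hw⟩ := Literature.AlgebraicGeometry.ShimuraVarieties.UnitaryCanonicalModel.exists_embedding_mem_negCone Jstar ι₁ hv
  obtain ⟨s', d', hs', hd', hfw⟩ := exists_forward_law_of_chartOfFrame hJ hΦ C hC σL uE hus' tt htt f₂ hf₂ w hw
  exact S.gal_comp_slice_fst_eq_sliceTwo_fst Kc C.𝓜.M τE hτE hJ hdet C.f f₂ ε ε₂ hε hε₂ γ σL hσγ hw hs' hd' hfw

end Summit.HodgeConjecture.HodgeConjecture.Theorems.F0P6aForwardLawAtChartOfFrame

end
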